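import Mathlib

/-!
# Crux `HilbertIntegralOverconvergentIsCongruence` (stmt-Langlands-8485), line `Sketch-ideate-r1-k1`,
# section K (Götzky–Koecher): stub `stub_eq_of_forall_segment` (K-C)

Section K of the line proves the Götzky–Koecher principle (Freitag, *Hilbert Modular Forms*, I.4.9).
The Fourier coefficient `a y` at height `y` in a convex set `C` (in the line: the cone of totally
positive vectors) is shown, by an identity-theorem argument carried out in other stubs, to be locally
constant along every line through every point of `C`, in the following weak form: for every `y ∈ C`
and every direction `v` there is `δ > 0` with `a (y + t • v) = a y` whenever `|t| < δ` and
`y + t • v ∈ C`.  This file proves the registered stub `stub_eq_of_forall_segment`, which upgrades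
that to constancy of `a` on `C`.

Proof.  Fix `y, y' ∈ C`, put `v := y' - y` and `φ t := a (y + t • v)` for `t` in the closed unit
interval (as a subtype).  By convexity `y + t • v ∈ C` for `t ∈ [0,1]`.  For `t₀ ∈ [0,1]` apply the
hypothesis at the point `y + t₀ • v ∈ C` in the direction `v`: since
`(y + t₀ • v) + (s - t₀) • v = y + s • v`, `φ s = φ t₀` whenever `|s - t₀| < δ`, so `φ` is locally
constant on the subtype `Set.Icc (0:ℝ) 1`.  This subtype is preconnected (`isPreconnected_Icc`),
hence `φ` is constant (`IsLocallyConstant.apply_eq_of_preconnectedSpace`), and `φ 0 = a y`,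
`φ 1 = a y'`.
-/

set_option linter.dupNamespace false -- mandated namespace `Summit.Langlands.Langlands.…` repeats a component

namespace Summit.Langlands.Langlands.Theorems.HilbertIntegralOverconvergentIsCongruence

/-- **Stub K-C.**  A function on a convex set `C ⊆ ℝ^τ` which is locally constant along every line
through every point of `C` (in the weak form produced by the identity-theorem step of section K) is
constant on `C`. -/
theorem stub_eq_of_forall_segment {τ : Type} [Fintype τ] (C : Set (τ → ℝ)) (hC : Convex ℝ C)
    (a : (τ → ℝ) → ℂ)
    (h : ∀ y ∈ C, ∀ v : τ → ℝ, ∃ δ > 0, ∀ t : ℝ, |t| < δ → y + t • v ∈ C → a (y + t • v) = a y)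
    {y y' : τ → ℝ} (hy : y ∈ C) (hy' : y' ∈ C) : a y = a y' := by
  -- the segment from `y` to `y'` lies in `C`
  have hseg : ∀ t : Set.Icc (0 : ℝ) 1, y + (t : ℝ) • (y' - y) ∈ C :=
    fun t ↦ hC.add_smul_sub_mem hy hy' t.2
  -- `φ t := a (y + t • (y' - y))` is locally constant on the closed unit interval
  have hφ : IsLocallyConstant (fun t : Set.Icc (0 : ℝ) 1 ↦ a (y + (t : ℝ) • (y' - y))) := by
    rw [IsLocallyConstant.iff_eventually_eq]
    intro t₀
    obtain ⟨δ, hδ, hδ'⟩ := h _ (hseg t₀) (y' - y)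
    rw [Metric.eventually_nhds_iff]
    refine ⟨δ, hδ, fun s hs ↦ ?_⟩
    have h1 : y + (s : ℝ) • (y' - y) = (y + (t₀ : ℝ) • (y' - y)) + ((s : ℝ) - t₀) • (y' - y) := by
      rw [sub_smul, add_assoc, add_sub_cancel]
    rw [h1]
    refine hδ' _ ?_ (h1 ▸ hseg s)
    rwa [← Real.dist_eq]
  haveI : PreconnectedSpace (Set.Icc (0 : ℝ) 1) := Subtype.preconnectedSpace isPreconnected_Icc
  have h01 := hφ.apply_eq_of_preconnectedSpace ⟨0, Set.left_mem_Icc.2 zero_le_one⟩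
    ⟨1, Set.right_mem_Icc.2 zero_le_one⟩
  simpa only [zero_smul, add_zero, one_smul, add_sub_cancel] using h01

end Summit.Langlands.Langlands.Theorems.HilbertIntegralOverconvergentIsCongruence
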